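import Literature.MathematicalPhysics.KineticTheory.LangevinChainGibbs

/-!
# Per-term covariance decay for the free finite Gibbs state (stub `stub_gibbsTermCovarianceDecay`),
# helper I: the Boltzmann weight of the chain in transfer form — algebra

Helper file for crux item stmt-AtomisticToContinuum-12009 (`LocalOhmBV.LocalOhm`, line `registered`,
stub T2 `stub_gibbsTermCovarianceDecay`). Pure algebra, no measure theory. On a one-site space `Y`
(for the chain: `Y = ℝ × ℝ`, position and momentum of one site) let `a : Y → ℝ` (the fourth root of
the one-site Boltzmann weight, `a = e^{-(p²/2+U(q))/4T}`), `K₀ : Y → Y → ℝ` (the bond Boltzmann factor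
`e^{-V(q'-q)/T}`), `k x y = a x K₀ x y a y` (the SYMMETRISED transfer kernel) and the weight of the
`N`-site chain relative to the product a priori measure `(a² dLeb)^{⊗N}`,
`w N ζ = (∏ᵢ a(ζᵢ)²) ∏ᵢ ∏ⱼ [j = i+1] K₀(ζᵢ, ζⱼ)` (the double product mirrors the double sum of
`OscillatorChain.hamiltonian`, so that the factorisation of `e^{-H_N/T}` is uniform in `N`). All four
objects enter through defining hypotheses (`hk`, `hw`, …); nothing is defined. Proved here:

* `prod_prod_ite_succ` — the nearest-neighbour double product over `Fin (n+1)` is the product over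
  the `n` bonds;
* `w_succ_eq` — `w (n+1) ζ = a(ζ₀) (∏_{i<n} k(ζᵢ, ζᵢ₊₁)) a(ζₙ)`;
* `w_append` — gluing two blocks: `w (l+m) (append ξ η) = w l ξ · w m η · K₀(ξ_{l-1}, η₀)`;
* `w_link_cons`, `w_append_succ` — the right block in the `Fin.cons` ("boundary spin") form consumed
  by the tree's heterogeneous path functionals (`SpecificHeatLimit.hetPath_spec`);
* `leftWeight_snoc_le` — freezing the last site `x` of a left block: the left weight is at most
  `a(x) · w` of the shorter block (`K₀ ≤ 1`);
* `gibbsDensity_unzip_eq` — for an `OscillatorChain`: `e^{-H_N(q,p)/T} = w N ζ · ∏ᵢ a(ζᵢ)²`,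
  `ζᵢ = (qᵢ, pᵢ)`.

All [folklore].
-/

set_option autoImplicit false

noncomputable section

namespace Summit.AtomisticToContinuum.FouriersLaw.Theorems.LocalOhmBirth.TermDecay

open MeasureTheory Filter Topology
open scoped BigOperators
open Literature.MathematicalPhysics.KineticTheory.HeatConduction

/-! ### Nearest-neighbour double products -/

/-- The nearest-neighbour double product `∏ᵢ ∏ⱼ [j = i + 1] F i j` over `Fin (n+1)` is the product
over the `n` bonds `(i, i+1)` (product version of `SpecificHeatLimit.sum_sum_ite_succ`). -/
theorem prod_prod_ite_succ {M : Type*} [CommMonoid M] {n : ℕ} (F : Fin (n + 1) → Fin (n + 1) → M) :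
    (∏ i : Fin (n + 1), ∏ j : Fin (n + 1), if j.val = i.val + 1 then F i j else 1) =
      ∏ i : Fin n, F (Fin.castSucc i) i.succ := by
  rw [Fin.prod_univ_castSucc]
  have hlast : (∏ j : Fin (n + 1), if j.val = (Fin.last n).val + 1 then F (Fin.last n) j else 1) = 1 := by
    refine Finset.prod_eq_one fun j _ => ?_
    rw [if_neg]
    rw [Fin.val_last]
    have := j.isLt
    omega
  rw [hlast, mul_one]
  refine Finset.prod_congr rfl fun i _ => ?_
  rw [Finset.prod_eq_single i.succ]
  · rw [if_pos]
    simp [Fin.val_succ]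
  · intro j _ hj
    rw [if_neg]
    intro h
    apply hj
    ext
    rw [h, Fin.val_succ, Fin.val_castSucc]
  · intro h
    exact absurd (Finset.mem_univ _) h

/-- The "link" block of the double product of a glued chain: among the pairs (left site `i`, right
site `j`) only the last left site and the first right site are neighbours. -/
theorem prod_prod_link (l m : ℕ) (G : Fin l → Fin m → ℝ) :
    (∏ i : Fin l, ∏ j : Fin m, if l + j.val = i.val + 1 then G i j else 1) =
      if h : 0 < l ∧ 0 < m then G ⟨l - 1, by omega⟩ ⟨0, h.2⟩ else 1 := by
  split_ifs with h
  · rw [Finset.prod_eq_single ⟨l - 1, by omega⟩]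
    · rw [Finset.prod_eq_single ⟨0, h.2⟩]
      · rw [if_pos]
        simp only
        omega
      · intro j _ hj
        rw [if_neg]
        intro hc
        apply hj
        ext
        simp only at hc ⊢
        omega
      · intro hc
        exact absurd (Finset.mem_univ _) hc
    · intro i _ hi
      refine Finset.prod_eq_one fun j _ => ?_
      rw [if_neg]
      intro hc
      apply hi
      ext
      have := i.isLt
      simp only
      omega
    · intro hc
      exact absurd (Finset.mem_univ _) hc
  · refine Finset.prod_eq_one fun i _ => Finset.prod_eq_one fun j _ => ?_
    rw [if_neg]
    intro _
    exact h ⟨i.pos, j.pos⟩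

/-! ### The weight of the chain relative to the product a priori measure -/

section Weight

variable {Y : Type*} {a : Y → ℝ} {K₀ k : Y → Y → ℝ} {w : (N : ℕ) → (Fin N → Y) → ℝ}

/-- The weight is non-negative (`K₀ ≥ 0`). -/
theorem w_nonneg
    (hw : ∀ (N : ℕ) (ζ : Fin N → Y), w N ζ = (∏ i, a (ζ i) ^ 2) *
      ∏ i : Fin N, ∏ j : Fin N, if j.val = i.val + 1 then K₀ (ζ i) (ζ j) else 1)
    (hK0 : ∀ x y, 0 ≤ K₀ x y) (N : ℕ) (ζ : Fin N → Y) : 0 ≤ w N ζ := by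
  rw [hw]
  refine mul_nonneg (Finset.prod_nonneg fun i _ => sq_nonneg _)
    (Finset.prod_nonneg fun i _ => Finset.prod_nonneg fun j _ => ?_)
  split_ifs
  · exact hK0 _ _
  · exact zero_le_one

/-- The weight of the empty chain is `1`. -/
theorem w_zero
    (hw : ∀ (N : ℕ) (ζ : Fin N → Y), w N ζ = (∏ i, a (ζ i) ^ 2) *
      ∏ i : Fin N, ∏ j : Fin N, if j.val = i.val + 1 then K₀ (ζ i) (ζ j) else 1)
    (ζ : Fin 0 → Y) : w 0 ζ = 1 := by
  rw [hw]
  simp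

/-- The weight of the one-site chain is `a²`. -/
theorem w_one
    (hw : ∀ (N : ℕ) (ζ : Fin N → Y), w N ζ = (∏ i, a (ζ i) ^ 2) *
      ∏ i : Fin N, ∏ j : Fin N, if j.val = i.val + 1 then K₀ (ζ i) (ζ j) else 1)
    (ζ : Fin 1 → Y) : w 1 ζ = a (ζ 0) ^ 2 := by
  rw [hw]
  simp

/-- **The weight in transfer form**: `w (n+1) ζ = a(ζ₀) (∏_{i<n} k(ζᵢ, ζᵢ₊₁)) a(ζₙ)` with the
symmetrised kernel `k x y = a x K₀ x y a y`. -/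
theorem w_succ_eq (hk : ∀ x y, k x y = a x * K₀ x y * a y)
    (hw : ∀ (N : ℕ) (ζ : Fin N → Y), w N ζ = (∏ i, a (ζ i) ^ 2) *
      ∏ i : Fin N, ∏ j : Fin N, if j.val = i.val + 1 then K₀ (ζ i) (ζ j) else 1)
    (n : ℕ) (ζ : Fin (n + 1) → Y) :
    w (n + 1) ζ = a (ζ 0) * (∏ i : Fin n, k (ζ (Fin.castSucc i)) (ζ i.succ)) * a (ζ (Fin.last n)) := by
  rw [hw, prod_prod_ite_succ]
  simp_rw [hk]
  rw [Finset.prod_mul_distrib, Finset.prod_mul_distrib]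
  have h1 : a (ζ 0) * ∏ i : Fin n, a (ζ i.succ) = ∏ i : Fin (n + 1), a (ζ i) :=
    (Fin.prod_univ_succ (fun i => a (ζ i))).symm
  have h2 : (∏ i : Fin n, a (ζ (Fin.castSucc i))) * a (ζ (Fin.last n)) = ∏ i : Fin (n + 1), a (ζ i) :=
    (Fin.prod_univ_castSucc (fun i => a (ζ i))).symm
  have h3 : ∏ i : Fin (n + 1), a (ζ i) ^ 2 = (∏ i : Fin (n + 1), a (ζ i)) * ∏ i : Fin (n + 1), a (ζ i) := by
    rw [← Finset.prod_mul_distrib]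
    exact Finset.prod_congr rfl fun i _ => sq _
  rw [h3]
  calc (∏ i : Fin (n + 1), a (ζ i)) * (∏ i : Fin (n + 1), a (ζ i)) *
        ∏ i : Fin n, K₀ (ζ (Fin.castSucc i)) (ζ i.succ)
      = (a (ζ 0) * ∏ i : Fin n, a (ζ i.succ)) * ((∏ i : Fin n, a (ζ (Fin.castSucc i))) * a (ζ (Fin.last n))) *
          ∏ i : Fin n, K₀ (ζ (Fin.castSucc i)) (ζ i.succ) := by rw [h1, h2]
    _ = _ := by ring

/-- **Gluing two blocks.** For `ξ : Fin l → Y`, `η : Fin m → Y`: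
`w (l+m) (append ξ η) = w l ξ · w m η · K₀(ξ_{l-1}, η₀)` (the last factor, the Boltzmann factor of
the connecting bond, is absent when one of the blocks is empty). -/
theorem w_append
    (hw : ∀ (N : ℕ) (ζ : Fin N → Y), w N ζ = (∏ i, a (ζ i) ^ 2) *
      ∏ i : Fin N, ∏ j : Fin N, if j.val = i.val + 1 then K₀ (ζ i) (ζ j) else 1)
    (l m : ℕ) (ξ : Fin l → Y) (η : Fin m → Y) :
    w (l + m) (Fin.append ξ η) = w l ξ * w m η *
      (if h : 0 < l ∧ 0 < m then K₀ (ξ ⟨l - 1, by omega⟩) (η ⟨0, h.2⟩) else 1) := by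
  have hs : (∏ i : Fin (l + m), a (Fin.append ξ η i) ^ 2) =
      (∏ i : Fin l, a (ξ i) ^ 2) * ∏ j : Fin m, a (η j) ^ 2 := by
    rw [Fin.prod_univ_add]
    simp only [Fin.append_left, Fin.append_right]
  have hb : (∏ i : Fin (l + m), ∏ j : Fin (l + m),
      if j.val = i.val + 1 then K₀ (Fin.append ξ η i) (Fin.append ξ η j) else 1) =
      (∏ i : Fin l, ∏ j : Fin l, if j.val = i.val + 1 then K₀ (ξ i) (ξ j) else 1) *
      (∏ i : Fin m, ∏ j : Fin m, if j.val = i.val + 1 then K₀ (η i) (η j) else 1) *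
      (if h : 0 < l ∧ 0 < m then K₀ (ξ ⟨l - 1, by omega⟩) (η ⟨0, h.2⟩) else 1) := by
    have hin : ∀ i : Fin (l + m), (∏ j : Fin (l + m),
        if j.val = i.val + 1 then K₀ (Fin.append ξ η i) (Fin.append ξ η j) else 1) =
        (∏ j : Fin l, if j.val = i.val + 1 then K₀ (Fin.append ξ η i) (ξ j) else 1) *
          ∏ j : Fin m, if l + j.val = i.val + 1 then K₀ (Fin.append ξ η i) (η j) else 1 := by
      intro i
      rw [Fin.prod_univ_add]
      simp only [Fin.append_left, Fin.append_right, Fin.val_castAdd, Fin.val_natAdd]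
    simp_rw [hin]
    rw [Fin.prod_univ_add]
    simp only [Fin.append_left, Fin.append_right, Fin.val_castAdd, Fin.val_natAdd]
    rw [Finset.prod_mul_distrib, Finset.prod_mul_distrib, prod_prod_link l m (fun i j => K₀ (ξ i) (η j))]
    have hRL : (∏ i : Fin m, ∏ j : Fin l, if j.val = l + i.val + 1 then K₀ (η i) (ξ j) else 1) = 1 :=
      Finset.prod_eq_one fun i _ => Finset.prod_eq_one fun j _ => by
        rw [if_neg]
        have := j.isLt
        omega
    have hRR : (∏ i : Fin m, ∏ j : Fin m, if l + j.val = l + i.val + 1 then K₀ (η i) (η j) else 1) =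
        ∏ i : Fin m, ∏ j : Fin m, if j.val = i.val + 1 then K₀ (η i) (η j) else 1 := by
      refine Finset.prod_congr rfl fun i _ => Finset.prod_congr rfl fun j _ => ?_
      by_cases hij : j.val = i.val + 1
      · rw [if_pos hij, if_pos (by omega)]
      · rw [if_neg hij, if_neg (by omega)]
    rw [hRL, hRR]
    ring
  rw [hw, hw l, hw m, hs, hb]
  ring

/-- **The right block in boundary-spin form.** For a boundary spin `u` and a block `η : Fin m → Y`:
`w m η · K₀(u, η₀) · a(u) = (∏_{j<m} k((u∷η)ⱼ, ηⱼ)) · a((u∷η)_m)` — the heterogeneous path weight of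
`SpecificHeatLimit.hetPath_spec` (all kernels equal to `k`) with the observable `a` at the last site. -/
theorem w_link_cons (hk : ∀ x y, k x y = a x * K₀ x y * a y)
    (hw : ∀ (N : ℕ) (ζ : Fin N → Y), w N ζ = (∏ i, a (ζ i) ^ 2) *
      ∏ i : Fin N, ∏ j : Fin N, if j.val = i.val + 1 then K₀ (ζ i) (ζ j) else 1)
    (m : ℕ) (u : Y) (η : Fin m → Y) :
    w m η * (if h : 0 < m then K₀ u (η ⟨0, h⟩) else 1) * a u =
      (∏ i : Fin m, k ((Fin.cons u η : Fin (m + 1) → Y) (Fin.castSucc i)) (η i)) *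
        a ((Fin.cons u η : Fin (m + 1) → Y) (Fin.last m)) := by
  cases m with
  | zero =>
    rw [w_zero hw, dif_neg (lt_irrefl 0)]
    simp
  | succ m =>
    rw [dif_pos (Nat.succ_pos m), w_succ_eq hk hw m η, Fin.prod_univ_succ, ← Fin.succ_last, Fin.cons_succ]
    simp only [Fin.castSucc_zero, Fin.cons_zero, ← Fin.succ_castSucc, Fin.cons_succ]
    rw [hk u (η 0)]
    have h0 : (⟨0, Nat.succ_pos m⟩ : Fin (m + 1)) = 0 := rfl
    rw [h0]
    ring

/-- **Gluing a non-empty left block and a right block in boundary-spin form**: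
`w (e+1+m) (append ξ η) = [a(ξ₀) ∏_{i<e} k(ξᵢ, ξᵢ₊₁)] · [(∏_{j<m} k((u∷η)ⱼ, ηⱼ)) a((u∷η)_m)]` with the
boundary spin `u = ξ_e` (the last site of the left block). -/
theorem w_append_succ (hk : ∀ x y, k x y = a x * K₀ x y * a y)
    (hw : ∀ (N : ℕ) (ζ : Fin N → Y), w N ζ = (∏ i, a (ζ i) ^ 2) *
      ∏ i : Fin N, ∏ j : Fin N, if j.val = i.val + 1 then K₀ (ζ i) (ζ j) else 1)
    (e m : ℕ) (ξ : Fin (e + 1) → Y) (η : Fin m → Y) :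
    w (e + 1 + m) (Fin.append ξ η) =
      (a (ξ 0) * ∏ i : Fin e, k (ξ (Fin.castSucc i)) (ξ i.succ)) *
        ((∏ i : Fin m, k ((Fin.cons (ξ (Fin.last e)) η : Fin (m + 1) → Y) (Fin.castSucc i)) (η i)) *
          a ((Fin.cons (ξ (Fin.last e)) η : Fin (m + 1) → Y) (Fin.last m))) := by
  rw [w_append hw, ← w_link_cons hk hw m (ξ (Fin.last e)) η, w_succ_eq hk hw e ξ]
  have h1 : (if h : 0 < e + 1 ∧ 0 < m then K₀ (ξ ⟨e + 1 - 1, by omega⟩) (η ⟨0, h.2⟩) else 1) =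
      if h : 0 < m then K₀ (ξ (Fin.last e)) (η ⟨0, h⟩) else 1 := by
    by_cases hm : 0 < m
    · rw [dif_pos ⟨Nat.succ_pos e, hm⟩, dif_pos hm]
      have : (⟨e + 1 - 1, by omega⟩ : Fin (e + 1)) = Fin.last e := Fin.ext (by simp)
      rw [this]
    · rw [dif_neg (fun h => hm h.2), dif_neg hm]
  rw [h1]
  ring

/-- **Freezing the last site of a left block.** For the left weight `L(ξ) = a(ξ₀) ∏_{i<e} k(ξᵢ, ξᵢ₊₁)`
(no trailing factor `a(ξ_e)`), a block `ξ'` of `e` sites and a frozen last spin `x`: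
`L(ξ' ∷ʳ x) ≤ a(x) · w e ξ'` (`0 < a`, `0 ≤ K₀ ≤ 1`: the connecting bond factor is dropped). -/
theorem leftWeight_snoc_le (hk : ∀ x y, k x y = a x * K₀ x y * a y)
    (hw : ∀ (N : ℕ) (ζ : Fin N → Y), w N ζ = (∏ i, a (ζ i) ^ 2) *
      ∏ i : Fin N, ∏ j : Fin N, if j.val = i.val + 1 then K₀ (ζ i) (ζ j) else 1)
    (ha0 : ∀ x, 0 < a x) (hK0 : ∀ x y, 0 ≤ K₀ x y) (hK1 : ∀ x y, K₀ x y ≤ 1)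
    (e : ℕ) (ξ' : Fin e → Y) (x : Y) :
    a ((Fin.snoc ξ' x : Fin (e + 1) → Y) 0) *
        ∏ i : Fin e, k ((Fin.snoc ξ' x : Fin (e + 1) → Y) (Fin.castSucc i))
          ((Fin.snoc ξ' x : Fin (e + 1) → Y) i.succ) ≤ a x * w e ξ' := by
  have hw1 : w (e + 1) (Fin.snoc ξ' x) = (a ((Fin.snoc ξ' x : Fin (e + 1) → Y) 0) *
      ∏ i : Fin e, k ((Fin.snoc ξ' x : Fin (e + 1) → Y) (Fin.castSucc i))
        ((Fin.snoc ξ' x : Fin (e + 1) → Y) i.succ)) * a x := by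
    rw [w_succ_eq hk hw, Fin.snoc_last]
  have hw2 : w (e + 1) (Fin.snoc ξ' x) ≤ w e ξ' * a x ^ 2 := by
    rw [← Fin.append_right_eq_snoc ξ' (fun _ => x), w_append hw, w_one hw]
    have hwe : 0 ≤ w e ξ' := w_nonneg hw hK0 e ξ'
    have hlink : (if h : 0 < e ∧ 0 < 1 then K₀ (ξ' ⟨e - 1, by omega⟩) ((fun _ : Fin 1 => x) ⟨0, h.2⟩)
        else 1) ≤ 1 := by
      split_ifs
      · exact hK1 _ _
      · exact le_rfl
    have hlink0 : 0 ≤ (if h : 0 < e ∧ 0 < 1 then K₀ (ξ' ⟨e - 1, by omega⟩) ((fun _ : Fin 1 => x) ⟨0, h.2⟩)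
        else 1) := by
      split_ifs
      · exact hK0 _ _
      · exact zero_le_one
    calc w e ξ' * a ((fun _ : Fin 1 => x) 0) ^ 2 *
          (if h : 0 < e ∧ 0 < 1 then K₀ (ξ' ⟨e - 1, by omega⟩) ((fun _ : Fin 1 => x) ⟨0, h.2⟩) else 1)
        ≤ w e ξ' * a x ^ 2 * 1 := by
          exact mul_le_mul_of_nonneg_left hlink (mul_nonneg hwe (sq_nonneg _))
      _ = w e ξ' * a x ^ 2 := mul_one _
  rw [hw1] at hw2
  have h3 : (a ((Fin.snoc ξ' x : Fin (e + 1) → Y) 0) *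
      ∏ i : Fin e, k ((Fin.snoc ξ' x : Fin (e + 1) → Y) (Fin.castSucc i))
        ((Fin.snoc ξ' x : Fin (e + 1) → Y) i.succ)) * a x ≤ (a x * w e ξ') * a x := by
    calc _ ≤ w e ξ' * a x ^ 2 := hw2
      _ = (a x * w e ξ') * a x := by ring
  exact le_of_mul_le_mul_right h3 (ha0 x)

/-- The left weight is non-negative (`0 ≤ a`, `0 ≤ K₀`). -/
theorem leftWeight_nonneg (hk : ∀ x y, k x y = a x * K₀ x y * a y) (ha0 : ∀ x, 0 ≤ a x)
    (hK0 : ∀ x y, 0 ≤ K₀ x y) (e : ℕ) (ξ : Fin (e + 1) → Y) :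
    0 ≤ a (ξ 0) * ∏ i : Fin e, k (ξ (Fin.castSucc i)) (ξ i.succ) :=
  mul_nonneg (ha0 _) (Finset.prod_nonneg fun i _ => by
    rw [hk]; exact mul_nonneg (mul_nonneg (ha0 _) (hK0 _ _)) (ha0 _))

/-- The left weight times the trailing site factor is the full weight:
`(a(ξ₀) ∏_{i<e} k(ξᵢ, ξᵢ₊₁)) · a(ξ_e) = w (e+1) ξ`. -/
theorem leftWeight_mul_a_last (hk : ∀ x y, k x y = a x * K₀ x y * a y)
    (hw : ∀ (N : ℕ) (ζ : Fin N → Y), w N ζ = (∏ i, a (ζ i) ^ 2) *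
      ∏ i : Fin N, ∏ j : Fin N, if j.val = i.val + 1 then K₀ (ζ i) (ζ j) else 1)
    (e : ℕ) (ξ : Fin (e + 1) → Y) :
    (a (ξ 0) * ∏ i : Fin e, k (ξ (Fin.castSucc i)) (ξ i.succ)) * a (ξ (Fin.last e)) = w (e + 1) ξ :=
  (w_succ_eq hk hw e ξ).symm

/-- Measurability of the weight (measurable `a`, `K₀`). -/
theorem measurable_w [MeasurableSpace Y]
    (hw : ∀ (N : ℕ) (ζ : Fin N → Y), w N ζ = (∏ i, a (ζ i) ^ 2) *
      ∏ i : Fin N, ∏ j : Fin N, if j.val = i.val + 1 then K₀ (ζ i) (ζ j) else 1)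
    (ham : Measurable a) (hK₀m : Measurable (Function.uncurry K₀)) (N : ℕ) :
    Measurable (w N) := by
  have h : w N = fun ζ => (∏ i, a (ζ i) ^ 2) *
      ∏ i : Fin N, ∏ j : Fin N, if j.val = i.val + 1 then K₀ (ζ i) (ζ j) else 1 := funext (hw N)
  rw [h]
  refine (Finset.measurable_prod _ fun i _ => ((ham.comp (measurable_pi_apply i)).pow_const 2)).mul
    (Finset.measurable_prod _ fun i _ => Finset.measurable_prod _ fun j _ => ?_)
  by_cases hij : j.val = i.val + 1
  · simp only [hij, if_true]
    have h1 : Measurable fun ζ : Fin N → Y => ζ i := measurable_pi_apply i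
    have h2 : Measurable fun ζ : Fin N → Y => ζ j := measurable_pi_apply j
    exact hK₀m.comp (h1.prodMk h2)
  · simp only [hij, if_false]
    exact measurable_const

/-- Measurability of the left weight (measurable `a`, `k`). -/
theorem measurable_leftWeight [MeasurableSpace Y] (ham : Measurable a)
    (hkm : Measurable (Function.uncurry k)) (e : ℕ) :
    Measurable fun ξ : Fin (e + 1) → Y => a (ξ 0) * ∏ i : Fin e, k (ξ (Fin.castSucc i)) (ξ i.succ) :=
  by
  refine (ham.comp (measurable_pi_apply 0)).mul (Finset.measurable_prod _ fun i _ => ?_)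
  have h1 : Measurable fun ξ : Fin (e + 1) → Y => ξ (Fin.castSucc i) := measurable_pi_apply _
  have h2 : Measurable fun ξ : Fin (e + 1) → Y => ξ i.succ := measurable_pi_apply _
  exact hkm.comp (h1.prodMk h2)

end Weight

/-! ### The Boltzmann weight of an oscillator chain -/

/-- **Factorisation of the Boltzmann weight of the `N`-site chain along the transfer structure**,
uniformly in `N`: with `a(q, p) = e^{-(p²/2+U(q))/4T}`, `K₀((q,p),(q',p')) = e^{-V(q'-q)/T}` and `w` as
above, `e^{-H_N(q, p)/T} = w N ζ · ∏ᵢ a(ζᵢ)²` for `ζᵢ = (qᵢ, pᵢ)`. -/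
theorem gibbsDensity_unzip_eq (P : OscillatorChain) (T : ℝ) {a : ℝ × ℝ → ℝ} {K₀ : ℝ × ℝ → ℝ × ℝ → ℝ}
    {w : (N : ℕ) → (Fin N → ℝ × ℝ) → ℝ}
    (ha : ∀ z, a z = Real.exp (-(z.2 ^ 2 / 2 + P.U z.1) / (4 * T)))
    (hK₀ : ∀ z z', K₀ z z' = Real.exp (-P.V (z'.1 - z.1) / T))
    (hw : ∀ (N : ℕ) (ζ : Fin N → ℝ × ℝ), w N ζ = (∏ i, a (ζ i) ^ 2) *
      ∏ i : Fin N, ∏ j : Fin N, if j.val = i.val + 1 then K₀ (ζ i) (ζ j) else 1)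
    (N : ℕ) (ζ : Fin N → ℝ × ℝ) :
    P.gibbsDensity N T ((fun i => (ζ i).1), (fun i => (ζ i).2)) = w N ζ * ∏ i, a (ζ i) ^ 2 := by
  have ha4 : ∀ z : ℝ × ℝ, Real.exp (-(z.2 ^ 2 / 2 + P.U z.1) / T) = a z ^ 2 * a z ^ 2 := by
    intro z
    rw [← pow_add, ha, ← Real.exp_nat_mul]
    congr 1
    push_cast
    rw [show -(z.2 ^ 2 / 2 + P.U z.1) / (4 * T) = (-(z.2 ^ 2 / 2 + P.U z.1) / 4) / T by
      rw [div_div]]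
    ring
  have hsite : Real.exp (-(∑ i : Fin N, ((ζ i).2 ^ 2 / 2 + P.U (ζ i).1)) / T) =
      (∏ i, a (ζ i) ^ 2) * ∏ i, a (ζ i) ^ 2 := by
    rw [neg_div, Finset.sum_div, ← Finset.sum_neg_distrib, Real.exp_sum, ← Finset.prod_mul_distrib]
    exact Finset.prod_congr rfl fun i _ => by rw [← neg_div, ha4]
  have hbond : Real.exp (-(∑ i : Fin N, ∑ j : Fin N,
      if j.val = i.val + 1 then P.V ((ζ j).1 - (ζ i).1) else 0) / T) =
      ∏ i : Fin N, ∏ j : Fin N, if j.val = i.val + 1 then K₀ (ζ i) (ζ j) else 1 := by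
    rw [neg_div, Finset.sum_div, ← Finset.sum_neg_distrib, Real.exp_sum]
    refine Finset.prod_congr rfl fun i _ => ?_
    rw [Finset.sum_div, ← Finset.sum_neg_distrib, Real.exp_sum]
    refine Finset.prod_congr rfl fun j _ => ?_
    split_ifs
    · rw [hK₀, neg_div]
    · simp
  unfold OscillatorChain.gibbsDensity OscillatorChain.hamiltonian
  dsimp only
  rw [neg_add, add_div, Real.exp_add, hsite, hbond, hw]
  ring


/-- **Headline (registered helper stub).** The factorisation of the Boltzmann weight of the `N`-site
oscillator chain along the transfer structure, uniformly in `N`: with `a = e^{-(p²/2+U(q))/4T}`,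
`K₀ = e^{-V(q'-q)/T}` and the weight `w` relative to `(a² dq dp)^{⊗N}`,
`e^{-H_N(q,p)/T} = w N ζ · ∏ᵢ a(ζᵢ)²` (`ζᵢ = (qᵢ, pᵢ)`). -/
theorem gibbsDensity_transfer_factorisation :
    ∀ (P : OscillatorChain) (T : ℝ) (a : ℝ × ℝ → ℝ) (K₀ : ℝ × ℝ → ℝ × ℝ → ℝ)
      (w : (N : ℕ) → (Fin N → ℝ × ℝ) → ℝ),
      (∀ z, a z = Real.exp (-(z.2 ^ 2 / 2 + P.U z.1) / (4 * T))) →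
      (∀ z z', K₀ z z' = Real.exp (-P.V (z'.1 - z.1) / T)) →
      (∀ (N : ℕ) (ζ : Fin N → ℝ × ℝ), w N ζ = (∏ i, a (ζ i) ^ 2) *
        ∏ i : Fin N, ∏ j : Fin N, if j.val = i.val + 1 then K₀ (ζ i) (ζ j) else 1) →
      ∀ (N : ℕ) (ζ : Fin N → ℝ × ℝ),
        P.gibbsDensity N T ((fun i => (ζ i).1), (fun i => (ζ i).2)) = w N ζ * ∏ i, a (ζ i) ^ 2 := by
  intro P T a K₀ w ha hK₀ hw N ζ
  exact gibbsDensity_unzip_eq P T ha hK₀ hw N ζ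

end Summit.AtomisticToContinuum.FouriersLaw.Theorems.LocalOhmBirth.TermDecay

end
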